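import Summits.BirchSwinnertonDyer.BirchSwinnertonDyer.Theorems.PrintCf2RamifiedOffTYZSquareSilenceTwoRPQFive
import HarnessLib

/-!
# Crux `PrintCf2.RamifiedOffTYZOfFacts` (stmt-BirchSwinnertonDyer-20509), line `offtyz-v7`, LEAD cycle 13 (cruxlead-20509 g12):
# THE SPLIT-PRIME FAMILY — ONE by-name theorem for every even `n` carrying a prime `p ≡ 1 (mod 8)` at which all other prime divisors are residues

THEOREMS ONLY (no `def`, no named fact, no `sorry`), `--supports stmt-BirchSwinnertonDyer-20509` (item 23431 = C⁺, even sectors, ANY number of primes).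

The cells `…TwoRPQFive` (p737408), the `(p/q) = +1` half of `…TwoRPQ`, and the two-prime cell of p735179 are all instances of ONE mechanism: a prime
`p ∣ n`, `p ≡ 1 (mod 8)`, with `(ℓ/p) = 1` for every other odd prime `ℓ ∣ n` — equivalently `p` splits completely in `L_n(i) = ℚ(i, √ℓ : ℓ ∣ n)` — gives
ONE Frobenius element `φ_p` that is `L_D(i)`-trivial on EVERY CM block `D ∋ p` (toolkit `TwoRPQFive.trivialOnL_of_frobenius_display`) and non-trivial
on `H_D` ((F5), conductor `4` on even blocks — g39's display — and conductor `2` on odd blocks — ty2's p736109).  So the coefficient-aware silence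
(p735302) closes the lower half of C⁺ as soon as the blocks AVOIDING `p` are harmless: an even block `D ≡ 6 (mod 8)`, `D ≠ n`, `p ∤ D` must be `2·prime`
or have a prime cofactor `n/D ≡ 1 (mod 8)` (even coefficient `|𝓛(n/D)|`, Thm. 1.1 parity), and an odd block `D ≡ 5 (mod 8)` with `p ∤ D` must be prime.
These are conditions on the integer `n` alone, so the result is ONE `OfFacts` statement for all `k`:
* `jacobiSym_neg_eq_one_of_split`, `two_dvd_scriptL_of_split_prime_of_valuePrinted₂`, ★ **`two_dvd_scriptL_of_split_prime_of_facts :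
  (tyz_cmPointRingClassFrobeniusValueData₂ ∧ thm11_parity_of_scriptL ∧ GZK) → ∀ n p, Squarefree n → n % 8 = 6 → p.Prime → p ∣ n → p % 8 = 1 →
  (∀ ℓ, ℓ.Prime → ℓ ∣ n → ℓ ≠ p → ℓ ≠ 2 → jacobiSym ℓ p = 1) → (even blocks avoiding p: 2·prime or prime cofactor ≡ 1 (8)) →
  (odd blocks ≡ 5 avoiding p: prime) → analytic rank 1 → generic generator → ∀ L, IsScriptL n L → 2 ∣ L`**.
Instances: `n = 2lq` (p735179: `p = l`), `n = 2rpq` with `q ≡ 1` and `(p/q) = 1`, or `q ≡ 5` and `(q/p) = 1` (p737408), and e.g. the four-prime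
`n = 2rpq₁q₂` with `r ≡ 3 (4)`, `q₁ ≡ q₂ ≡ 1 (8)`, all residues at `p` (blocks `2rq₁q₂, 2rqᵢ` need `p`-free treatment: cofactors `p`, `pq_j` — the
first is prime `≡ 1 (8)`, the second is NOT prime, so that `n` needs `p ∣ D` or a second split prime: the hypothesis records exactly what is required).
Beyond-print theorem: YES (conditional on the three named facts).  BSD is not proved by any of this; no class is closed by this file.

References: [cite: TianYuanZhang2017, Thm. 1.1, §1 (p0002 L101–L110), §3.1 (p0011 L1–L73), Prop. 3.2 (1)(2), Thm. 3.5, Thm. 3.6 (1)(2), Lemma 3.18,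
proof of Lemma 3.21 (p0020 L27–L63)]; [cite: Cox2013, §5.C Lemma 5.19, (5.20), (5.22), Thm. 5.23, Cor. 5.25, §9.A]; [cite: Darmon2004, Thm. 3.22].
-/

noncomputable section

open scoped Classical

open WeierstrassCurve WeierstrassCurve.Affine Finset Literature.NumberTheory.EllipticCurves
  Literature.NumberTheory.EllipticCurves.TianYuanZhang2017
  Literature.NumberTheory.EllipticCurves.TianYuanZhang2017.W2
  Summit.BirchSwinnertonDyer.Rank1Residual.P2.GenusPeriodTransferLayer
  Summit.BirchSwinnertonDyer.Rank1Residual.P2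
  Summit.BirchSwinnertonDyer.PrintCf2.MoverAssembly
  Summit.BirchSwinnertonDyer.PrintCf2.SquareSilenceEven
  Summit.BirchSwinnertonDyer.PrintCf2.SquareSilenceCoefficients
  Summit.BirchSwinnertonDyer.PrintCf2.LowerHalfTwoPrimesEvenDisplays
  Summit.BirchSwinnertonDyer.PrintCf2.TwoRPQFive

set_option autoImplicit false

namespace Summit.BirchSwinnertonDyer.PrintCf2.SplitPrime

variable {n : ℕ}

/-- The Euler symbols of a split prime: `p ≡ 1 (mod 8)` and `(ℓ/p) = 1` for the odd primes `ℓ ∣ n`, `ℓ ≠ p`, give `(−ℓ/p) = 1` for EVERY prime `ℓ ∣ n`,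
`ℓ ≠ p` (`(−1/p) = (−2/p) = 1`). [cite: Cox2013, §1 (1.13)–(1.15), §5.C (5.20), (5.22)] -/
theorem jacobiSym_neg_eq_one_of_split {p : ℕ} (hp : p.Prime) (hp8 : p % 8 = 1)
    (hsym : ∀ ℓ : ℕ, ℓ.Prime → ℓ ∣ n → ℓ ≠ p → ℓ ≠ 2 → jacobiSym ℓ p = 1)
    {ℓ : ℕ} (hℓ : ℓ.Prime) (hℓn : ℓ ∣ n) (hℓp : ℓ ≠ p) : jacobiSym (-(ℓ : ℤ)) p = 1 := by
  by_cases hℓ2 : ℓ = 2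
  · subst hℓ2
    rw [show (-((2 : ℕ) : ℤ)) = -2 by norm_num]
    exact jacobiSym_neg_two_eq_one hp (by omega)
  · rw [neg_eq_neg_one_mul, jacobiSym.mul_left, jacobiSym_neg_one_eq_one hp (by omega), one_mul]
    exact hsym ℓ hℓ hℓn hℓp hℓ2

/-- **THE LOWER HALF OF C⁺ FOR A SPLIT PRIME**, display shape over `D.Printed ∧ D.CMPointRingClassFrobeniusValuePrinted₂`: `n ≡ 6 (mod 8)` square-free
with a prime `p ∣ n`, `p ≡ 1 (mod 8)`, `(ℓ/p) = 1` for the other odd primes `ℓ ∣ n`; every even block `D ≠ n` avoiding `p` is `2·prime` or has a prime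
cofactor `≡ 1 (mod 8)`; every odd block `≡ 5 (mod 8)` avoiding `p` is prime.  Then `2 ∣ L` whenever `𝓛(n)² = L²` (generic generator).
[cite: TianYuanZhang2017, Thm. 1.1, Thm. 3.5, Lemma 3.18, §3.1, Prop. 3.2 (1)(2), Thm. 3.6 (1)(2), proof of Lemma 3.21] [cite: Cox2013, §5.C Cor. 5.25, §9.A] [cite: Darmon2004, Thm. 3.22] -/
theorem two_dvd_scriptL_of_split_prime_of_valuePrinted₂ (hGZK : rank_eq_analyticRank_of_analyticRank_le_one) (h11 : thm11_parity_of_scriptL)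
    (hsq : Squarefree n) (h6 : n % 8 = 6) {p : ℕ} (hp : p.Prime) (hpn : p ∣ n) (hp8 : p % 8 = 1)
    (hsym : ∀ ℓ : ℕ, ℓ.Prime → ℓ ∣ n → ℓ ≠ p → ℓ ≠ 2 → jacobiSym ℓ p = 1)
    (heven : ∀ d : ℕ, d ∣ n → d % 8 = 6 → d ≠ n → ¬ p ∣ d →
      (∃ ℓ : ℕ, ℓ.Prime ∧ d = 2 * ℓ) ∨ (∃ ℓ : ℕ, ℓ.Prime ∧ ℓ % 8 = 1 ∧ n = d * ℓ))
    (hodd : ∀ d : ℕ, d ∣ n → d % 8 = 5 → ¬ p ∣ d → d.Prime)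
    (hra : haveI := isElliptic_congruentNumberCurve hsq.ne_zero; (congruentNumberCurve n).analyticRank = 1)
    (D : GenusPointData n) (hPr : D.Printed) (hV : D.CMPointRingClassFrobeniusValuePrinted₂)
    {x y : ℚ} (hxy : (congruentNumberCurve n).toAffine.Nonsingular x y)
    (hgen : haveI := isElliptic_congruentNumberCurve hsq.ne_zero;
      ∀ P, ∃ k : ℤ, IsOfFinAddOrder (P - k • (Point.some x y hxy : (congruentNumberCurve n).toAffine.Point)))
    (hx : ¬ ∃ r : ℚ, x = r ^ 2 ∨ x = -r ^ 2 ∨ x = n * r ^ 2 ∨ x = -(n * r ^ 2))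
    (hx2 : ¬ ∃ r : ℚ, x = 2 * r ^ 2 ∨ x = -(2 * r ^ 2) ∨ x = 2 * n * r ^ 2 ∨ x = -(2 * n * r ^ 2)) :
    ∀ L : ℤ, IsScriptL n L → (2 : ℤ) ∣ L := by
  have hn0 : n ≠ 0 := hsq.ne_zero
  have hnn : n ∈ n.divisors := Nat.mem_divisors_self n hn0
  have hp2 : p ≠ 2 := by omega
  have hmem : ∀ {d : ℕ}, d ∣ n → d ∈ n.divisors := fun hd => Nat.mem_divisors.mpr ⟨hd, hn0⟩
  have v1 : jacobiSym (-1) p = 1 := jacobiSym_neg_one_eq_one hp (by omega)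
  obtain ⟨hLs, -, hrec, -, h35, -, -, -, h318, -, -⟩ := hPr
  obtain ⟨z, Φ, ΓH, ΓH', σ, θ, c, ρ₂, ρ₄, hc, hb⟩ := hV
  -- a displayed `φ_p` on a block `d ∋ p` is `L_d(i)`-trivial
  have hL : ∀ {d : ℕ}, d ∣ n → p ∣ d → ∀ {φ : D.H ≃ₐ[ℚ] D.H}, φ (D.sqrtNeg d) = D.sqrtNeg d →
      φ D.im = (jacobiSym (-1) p) • D.im →
      (∀ r' : ℕ, r'.Prime → r' ∣ n → r' ≠ p → φ (D.sqrtNeg r') = (jacobiSym (-(r' : ℤ)) p) • D.sqrtNeg r') → D.TrivialOnL d φ :=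
    fun hd hpd _ hF1 hFi hFr => TwoRPQFive.trivialOnL_of_frobenius_display D hsq hd hp hpd v1
      (fun ℓ hℓ hℓd hne => jacobiSym_neg_eq_one_of_split hp hp8 hsym hℓ (hℓd.trans hd) hne) hF1 hFi hFr
  -- the top witness `φ_p` (conductor 4)
  obtain ⟨φ, hF1, hF2, hFi, hFr, hF5⟩ := D.exists_frobenius_not_mem_of_clauses₂_six hsq hb hnn h6 hp hpn hp2
  refine two_dvd_scriptL_of_coefficients_even_of_x_not_mem D hGZK hsq h6 hra hrec h35 hLs h318 z Φ ΓH ΓH' σ c hc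
    (fun d hd => ⟨(hb d hd).1, (hb d hd).2.2.1⟩) ⟨φ, hL dvd_rfl hpn hF1 hFi hFr, hF2, hF5⟩ (fun d hd hd6 hdn => ?_) (fun d hd hd5 => ?_)
    hxy hgen hx hx2
  · -- proper even blocks: through `p` (witness `φ_p`), `2·prime` (free), or prime cofactor `≡ 1 (mod 8)` (even coefficient)
    have hdn' : d ∣ n := Nat.dvd_of_mem_divisors hd
    by_cases hpd : p ∣ d
    · obtain ⟨ψ, hG1, hG2, hGi, hGr, hG5⟩ := D.exists_frobenius_not_mem_of_clauses₂_six hsq hb hd hd6 hp hpd hp2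
      exact Or.inr (Or.inl ⟨ψ, hL hdn' hpd hG1 hGi hGr, hG2, hG5⟩)
    · rcases heven d hdn' hd6 hdn hpd with ⟨ℓ, hℓ, rfl⟩ | ⟨ℓ, hℓ, hℓ8, hnd⟩
      · exact Or.inl ⟨ℓ, hℓ, rfl⟩
      · refine Or.inr (Or.inr ?_)
        have hd0 : 0 < d := Nat.pos_of_mem_divisors hd
        rw [show n / d = ℓ by rw [hnd]; exact Nat.mul_div_cancel_left ℓ hd0]
        exact even_scriptL_of_prime_one_mod_eight h11 D hLs hℓ hℓ8 (hmem ⟨d, by rw [hnd]; ring⟩)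
  · -- odd blocks `≡ 5`: prime, or through `p` (witness `φ_p`, conductor 2)
    have hdn' : d ∣ n := Nat.dvd_of_mem_divisors hd
    by_cases hdP : d.Prime
    · exact Or.inl hdP
    · have hpd : p ∣ d := by
        by_contra h
        exact hdP (hodd d hdn' hd5 h)
      have hne : p ≠ d := by rintro rfl; exact hdP hp
      obtain ⟨ψ, hG1, hG2, hGi, hGr, hG5⟩ := D.exists_frobenius_not_mem_of_clauses₂ hsq hb hd hd5 hp hpd hne
      exact Or.inr ⟨ψ, hL hdn' hpd hG1 hGi hGr, hG2, hG5⟩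

/-- **THE LOWER HALF OF C⁺ FOR A SPLIT PRIME, FROM THE NAMED FACTS** (`OfFacts` shape, by-name closable; ONE statement for every number of prime factors):
`(tyz_cmPointRingClassFrobeniusValueData₂ ∧ thm11_parity_of_scriptL ∧ GZK)` implies — for square-free `n ≡ 6 (mod 8)` and a prime `p ∣ n`, `p ≡ 1 (mod 8)`,
such that (i) `(ℓ/p) = 1` for every odd prime `ℓ ∣ n`, `ℓ ≠ p`; (ii) every divisor `d ∣ n`, `d ≡ 6 (mod 8)`, `d ≠ n`, `p ∤ d` is twice a prime or has
`n = d·ℓ` with `ℓ` a prime `≡ 1 (mod 8)`; (iii) every divisor `d ∣ n`, `d ≡ 5 (mod 8)`, `p ∤ d` is prime — if `ord_{s=1} L(E_n, s) = 1` and `E_n(ℚ)` has a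
generator `R = (x, y)` modulo torsion with `x ∉ {±1, ±2, ±n, ±2n}·ℚ^{×2}`, then `2 ∣ L` whenever `𝓛(n)² = L²`.
[cite: TianYuanZhang2017, Thm. 1.1, §1, §3, Prop. 3.2 (1)(2)] [cite: Cox2013, §5.C Cor. 5.25, §9.A] [cite: HeathBrown1994SelmerCongruentII, §1] [cite: Darmon2004, Thm. 3.22] -/
theorem two_dvd_scriptL_of_split_prime_of_facts :
    (tyz_cmPointRingClassFrobeniusValueData₂ ∧ thm11_parity_of_scriptL ∧ rank_eq_analyticRank_of_analyticRank_le_one) →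
      ∀ n p : ℕ, (hsq : Squarefree n) → n % 8 = 6 → p.Prime → p ∣ n → p % 8 = 1 →
        (∀ ℓ : ℕ, ℓ.Prime → ℓ ∣ n → ℓ ≠ p → ℓ ≠ 2 → jacobiSym ℓ p = 1) →
        (∀ d : ℕ, d ∣ n → d % 8 = 6 → d ≠ n → ¬ p ∣ d →
          (∃ ℓ : ℕ, ℓ.Prime ∧ d = 2 * ℓ) ∨ (∃ ℓ : ℕ, ℓ.Prime ∧ ℓ % 8 = 1 ∧ n = d * ℓ)) →
        (∀ d : ℕ, d ∣ n → d % 8 = 5 → ¬ p ∣ d → d.Prime) →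
        (haveI := isElliptic_congruentNumberCurve hsq.ne_zero; (congruentNumberCurve n).analyticRank = 1) →
        ∀ (x y : ℚ) (hxy : (congruentNumberCurve n).toAffine.Nonsingular x y),
          (haveI := isElliptic_congruentNumberCurve hsq.ne_zero;
            ∀ P, ∃ k : ℤ, IsOfFinAddOrder (P - k • (Point.some x y hxy : (congruentNumberCurve n).toAffine.Point))) →
          (¬ ∃ r : ℚ, x = r ^ 2 ∨ x = -r ^ 2 ∨ x = n * r ^ 2 ∨ x = -(n * r ^ 2)) →
          (¬ ∃ r : ℚ, x = 2 * r ^ 2 ∨ x = -(2 * r ^ 2) ∨ x = 2 * n * r ^ 2 ∨ x = -(2 * n * r ^ 2)) →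
            ∀ L : ℤ, IsScriptL n L → (2 : ℤ) ∣ L := by
  intro h n p hsq h6 hp hpn hp8 hsym heven hodd hra x y hxy hgen hx hx2
  obtain ⟨D, hPr, hV⟩ := h.1 n hsq (Or.inr (Or.inl h6))
  exact two_dvd_scriptL_of_split_prime_of_valuePrinted₂ h.2.2 h.2.1 hsq h6 hp hpn hp8 hsym heven hodd hra D hPr hV hxy hgen hx hx2

end Summit.BirchSwinnertonDyer.PrintCf2.SplitPrime

end
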